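import Summits.CriticalPhenomena.Ising3D.TaylorTableHeadPartsL
import HarnessLib

/-!
# The TABLE layer of a derivative certificate, XXXIII: part checks depend on the Taylor-model tables only through the levels they read
(cell `pub-ising3x`, seat boot-1 gen 10; gate (g2) — replay layout: BLANKED literal tables per file)

HONEST FRAMING: lottery ticket; floor = tightest certified 3D Ising CFT bounds; no exact-solution
claim without a proof. Island framing: certified exclusion region at stated derivative order and
assumptions; not a determination of the 3D Ising critical exponents beyond that.

A replay file holding the one-term parts of a few levels of a head cell carries the three Taylor-model tables as literals BLANKED to
the positions those parts read (the full tables are ≈ 360 KB; a file may hold ≤ 512 KB), plus ONE kernel equality per used position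
`(C.tmsS R.S t₁ t₂).getD pos [] = TS_pos` (HEAD-DELTA.md §8.4). This file proves that this is enough: `headPolyTM` (hence `famTriple`,
`oddPartOKL`, `evenPartOKL`) depends on a table only through `rowEntry tms nF n j = (tms.getD (nF − n) []).getD j []` at the levels `n`
of the slice, so two tables that agree at those positions give the same check (`headPolyTM_congr`, `oddPartOKL_congr`,
`evenPartOKL_congr`), and the landed check follows from the blanked-table check plus the position equalities
(`oddHeadPartOKΔ_of_positions`, `evenHeadPartOKΔ_of_positions`). Elementary (list induction). [folklore]
-/

namespace Summit.CriticalPhenomena.Ising3D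

open Literature.Analysis.ValidatedNumerics Literature.Analysis.ValidatedNumerics.PolyMP
open Literature.Analysis.ValidatedNumerics.NumericsMP (MI)
open Literature.MathematicalPhysics.QuantumFieldTheory.ConformalBootstrap3D
open Literature.MathematicalPhysics.QuantumFieldTheory.ConformalBootstrap3D.HRTM (rowEntry pivOK)

/-- Two tables AGREE on a slice: equal rows at every position `nF − n` the slice reads. [folklore] -/
def TablesAgreeOn (tms tms' : List (List IPoly)) (nF : ℕ) (sl : List (ℕ × ℕ)) : Prop :=
  ∀ q ∈ sl, tms.getD (nF - q.1) [] = tms'.getD (nF - q.1) []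

/-- `rowEntry` reads one position. [folklore] -/
theorem rowEntry_congr {tms tms' : List (List IPoly)} {nF n : ℕ} (h : tms.getD (nF - n) [] = tms'.getD (nF - n) []) (j : ℕ) :
    HRTM.rowEntry tms nF n j = HRTM.rowEntry tms' nF n j := by
  unfold HRTM.rowEntry; rw [h]

/-- **`headPolyTM` depends on the table only through the positions of its slice.** [folklore] -/
theorem headPolyTM_congr (S : ℕ) (rows : List IPoly) {tms tms' : List (List IPoly)} (nF ℓ : ℕ) (ctr : ℚ) :
    ∀ sl : List (ℕ × ℕ), TablesAgreeOn tms tms' nF sl →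
      headPolyTM S rows tms nF ℓ ctr sl = headPolyTM S rows tms' nF ℓ ctr sl
  | [], _ => rfl
  | q :: qs, h => by
      simp only [headPolyTM]
      rw [rowEntry_congr (h q List.mem_cons_self) q.2,
        headPolyTM_congr S rows nF ℓ ctr qs fun q' hq' => h q' (List.mem_cons_of_mem _ hq')]

/-- The same for family triples. [folklore] -/
theorem famTriple_congr (S : ℕ) (R0 R1 R2 : List IPoly) {tms tms' : List (List IPoly)} (C : EvenCellTM) {sl : List (ℕ × ℕ)}
    (h : TablesAgreeOn tms tms' C.nF sl) : famTriple S R0 R1 R2 tms C sl = famTriple S R0 R1 R2 tms' C sl := by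
  simp only [famTriple, headPolyTM_congr S R0 C.nF C.ℓ C.ctr sl h, headPolyTM_congr S R1 C.nF C.ℓ C.ctr sl h,
    headPolyTM_congr S R2 C.nF C.ℓ C.ctr sl h]

/-- **The odd literal-table part check is invariant under replacing the tables by ones agreeing on the part's slice.** [folklore] -/
theorem oddPartOKL_congr (R : OddHeadRowsΔ) (C : EvenCellTM) {tS tS' tP tP' tM tM' : List (List IPoly)} (p : HeadPartOdd)
    (hS : TablesAgreeOn tS tS' C.nF ((C.F.drop p.t0).take p.count)) (hP : TablesAgreeOn tP tP' C.nF ((C.F.drop p.t0).take p.count))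
    (hM : TablesAgreeOn tM tM' C.nF ((C.F.drop p.t0).take p.count)) :
    oddPartOKL R C tS tP tM p = oddPartOKL R C tS' tP' tM' p := by
  simp only [oddPartOKL, famTriple_congr R.S _ _ _ C hS, famTriple_congr R.S _ _ _ C hP,
    headPolyTM_congr R.S (R.rows 3 0) C.nF C.ℓ C.ctr _ hM]

/-- **Odd part check from BLANKED literal tables**: tables that agree with the kernel's tables on the part's slice suffice. [folklore] -/
theorem oddHeadPartOKΔ_of_positions {R : OddHeadRowsΔ} {C : EvenCellTM} {t₁ t₂ : ℚ} {tS tP tM : List (List IPoly)} {p : HeadPartOdd}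
    (hS : TablesAgreeOn tS (C.tmsS R.S t₁ t₂) C.nF ((C.F.drop p.t0).take p.count))
    (hP : TablesAgreeOn tP (C.tmsP R.S t₁ t₂) C.nF ((C.F.drop p.t0).take p.count))
    (hM : TablesAgreeOn tM (C.tmsM R.S t₁ t₂) C.nF ((C.F.drop p.t0).take p.count))
    (h : oddPartOKL R C tS tP tM p = true) : oddHeadPartOKΔ R C t₁ t₂ p = true := by
  rw [oddHeadPartOKΔ_eq_oddPartOKL, ← oddPartOKL_congr R C p hS hP hM]; exact h

/-- The even check with a table argument is invariant likewise (one table, three row families). [folklore] -/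
theorem evenPartOKL_congr (R : HeadRowsΔ) (C : EvenCellTM) {tms tms' : List (List IPoly)} (p : HeadPart3)
    (h : TablesAgreeOn tms tms' C.nF ((C.F.drop p.t0).take p.count)) : evenPartOKL R C tms p = evenPartOKL R C tms' p := by
  have h0 : TablesAgreeOn tms tms' C.nF (p.ord0.slice C.F) := h
  have h1 : TablesAgreeOn tms tms' C.nF (p.ord1.slice C.F) := h
  have h2 : TablesAgreeOn tms tms' C.nF (p.ord2.slice C.F) := h
  simp only [evenPartOKL, headPartOKWith, headPolyTM_congr _ _ C.nF C.ℓ C.ctr _ h0, headPolyTM_congr _ _ C.nF C.ℓ C.ctr _ h1,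
    headPolyTM_congr _ _ C.nF C.ℓ C.ctr _ h2]

/-- **Even part check from a BLANKED literal table.** [folklore] -/
theorem evenHeadPartOKΔ_of_positions {R : HeadRowsΔ} {C : EvenCellTM} {tms : List (List IPoly)} {p : HeadPart3}
    (ht : TablesAgreeOn tms (HRTM.rows R.S C.ctr C.ℓ C.e C.D C.nF) C.nF ((C.F.drop p.t0).take p.count))
    (h : evenPartOKL R C tms p = true) : evenHeadPartOKΔ R C p = true := by
  rw [evenHeadPartOKΔ_eq_evenPartOKL, ← evenPartOKL_congr R C p ht]; exact h

/-- How a replay file discharges `TablesAgreeOn` for a ONE-term part: a single position equality. [folklore] -/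
theorem tablesAgreeOn_singleton {tms tms' : List (List IPoly)} {nF : ℕ} {q : ℕ × ℕ}
    (h : tms.getD (nF - q.1) [] = tms'.getD (nF - q.1) []) : TablesAgreeOn tms tms' nF [q] := by
  intro q' hq'
  rw [List.mem_singleton] at hq'
  subst hq'
  exact h

end Summit.CriticalPhenomena.Ising3D
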